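import Literature.Computability.Learning.ColumnDesignTables
import Literature.Computability.Learning.ModpDesignFP
import HarnessLib

/-!
# The `AC⁰[p]` learner: its NW design is a column design (tables of the NW predictor)

Groundwork for the named fact `Literature.Computability.Learning.cikk_learn_AC0Mod` (CIKK 2016,
Cor. 5.4). The learner's `AC⁰[p]`-computable NW design `designP = designC 𝔭 t` over `𝔽_p[X]/(P)`
(`GFDesignConcrete.lean`, CIKK Thm. 3.3/3.6), with blocks of any size `n' ≤ pᵗ` indexed by
`Fin (2^ℓ)`, is a COLUMN design in the sense of `ColumnDesignTables.lean`: block `i` is the graph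
`τ ↦ (τ, colVal i τ)` with `colVal` the column program `colValL` of `GFDesignList.lean`
(`designP_val`, `isColumnDesign_designP`). The generic layer of `ColumnDesignTables.lean`
(`ColDesign.matching/idxOf/patInput/tableList/…` at `cv := Modp.colVal (𝔭 ^ t) ℓ`) then gives the
tables of the NW predictor: `card_matching_le` and `nwPredictor_eq_predictOfTables` are its
specialisations to this design (CIKK §2.4).

## References

* M. Carmosino, R. Impagliazzo, V. Kabanets, A. Kolokolova, *Learning algorithms from natural
  proofs*, CCC 2016, §2.4 (NW reconstruction algorithm), §3.1, Thm. 3.3, Thm. 3.6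
  [CarmosinoImpagliazzoKabanetsKolokolova2016].
-/

namespace Literature.Computability.Learning

namespace Modp

open Literature.Computability.Complexity Literature.Computability.MetaComplexity
  Literature.Computability.MetaComplexity.GFDesign Literature.Computability.Cryptography _root_.Computability Finset

section Tables

variable [P : PrimeP] {t n' ℓ : ℕ} (ht : t ≠ 0) (hn : n' ≤ 𝔭 ^ t)

/-- **The learner's NW design**: the `AC⁰[p]`-computable design `designC` over `𝔽_p[X]/(P)`,
`pᵗ ≥ n'`, with blocks of size `n'` (the inputs of the amplified function) indexed by `Fin (2^ℓ)`
through the standard enumeration of `{0,1}^ℓ`. [cite: CarmosinoImpagliazzoKabanetsKolokolova2016, Thm. 3.3 / Thm. 3.6] -/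
noncomputable def designP {t : ℕ} (ht : t ≠ 0) (n' ℓ : ℕ) (hn : n' ≤ 𝔭 ^ t) :
    Fin (2 ^ ℓ) → (Fin n' ↪ Fin (𝔭 ^ t * 𝔭 ^ t)) :=
  fun i => designC 𝔭 ht n' ℓ hn ((boolFunEquivFin ℓ).symm i)

/-- The learner's design is an NW design with intersections `≤ ℓ`. [cite: CarmosinoImpagliazzoKabanetsKolokolova2016, Thm. 3.3] -/
theorem isNWDesign_designP {t : ℕ} (ht : t ≠ 0) (n' ℓ : ℕ) (hn : n' ≤ 𝔭 ^ t) :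
    IsNWDesign ℓ (designP ht n' ℓ hn) :=
  (isNWDesign_designC 𝔭 ht n' ℓ hn).comp_injective (boolFunEquivFin ℓ).symm.injective

/-- The NW output `g_z` of the learner's generator for the hard function `g`, read as an
`ℓ`-variate function, is `v ↦ g(z|_{S_v})`. [folklore] -/
theorem nwGenerator_designP_comp {t : ℕ} (ht : t ≠ 0) (n' ℓ : ℕ) (hn : n' ≤ 𝔭 ^ t)
    (g : (Fin n' → Bool) → Bool) (z : Fin (𝔭 ^ t * 𝔭 ^ t) → Bool) :
    (nwGenerator (designP ht n' ℓ hn) g z) ∘ boolFunEquivFin ℓ = fun v => g (z ∘ designC 𝔭 ht n' ℓ hn v) := by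
  funext v
  simp [designP, nwGenerator]

/-- The column value of block `i` at column `τ`: the column program `colValL` of the design on the
bit string of `i` (`Q` the field size). [cite: CarmosinoImpagliazzoKabanetsKolokolova2016, §3.1 / Thm. 3.6] -/
def colVal (Q ℓ : ℕ) (i : Fin (2 ^ ℓ)) (τ : ℕ) : ℕ :=
  colValL 𝔭 Q ℓ (List.ofFn ((boolFunEquivFin ℓ).symm i)) τ

include ht hn in
/-- The position of the learner's design in column `τ`. [folklore] -/
theorem designP_val (i : Fin (2 ^ ℓ)) (τ : Fin n') :
    ((designP ht n' ℓ hn i τ : Fin (𝔭 ^ t * 𝔭 ^ t)) : ℕ) = colVal (𝔭 ^ t) ℓ i τ + 𝔭 ^ t * τ := by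
  rw [designP, designC_val_colValL]; rfl

include ht hn in
/-- **The learner's design is a column design** with column values `colVal (pᵗ) ℓ`: two positions
coincide iff they are in the same column with matching column values. [folklore] -/
theorem isColumnDesign_designP : ColDesign.IsColumnDesign (colVal (𝔭 ^ t) ℓ) (designP ht n' ℓ hn) := by
  intro i j s τ
  have hq : 0 < 𝔭 ^ t := pow_pos P.prime.pos t
  rw [Fin.ext_iff, designP_val ht hn, designP_val ht hn, ColDesign.colMatch]
  have h1 : colVal (𝔭 ^ t) ℓ i s < 𝔭 ^ t := colValL_lt 𝔭 hq _ _ _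
  have h2 : colVal (𝔭 ^ t) ℓ j τ < 𝔭 ^ t := colValL_lt 𝔭 hq _ _ _
  constructor
  · intro h
    have hs : (s : ℕ) = τ := by
      have := congrArg (· / 𝔭 ^ t) h
      simp only [Nat.add_mul_div_left _ _ hq, Nat.div_eq_of_lt h1, Nat.div_eq_of_lt h2,
        zero_add] at this
      exact this
    obtain rfl : s = τ := Fin.ext hs
    exact ⟨rfl, Nat.add_right_cancel h⟩
  · rintro ⟨rfl, h⟩
    rw [h]

include ht hn in
/-- **Design property**: distinct blocks of the learner's design match in at most `ℓ` columns.
[cite: CarmosinoImpagliazzoKabanetsKolokolova2016, §3.1 (Thm. 3.3)] -/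
theorem card_matching_le {i j : Fin (2 ^ ℓ)} (hij : i ≠ j) :
    (ColDesign.matching (colVal (𝔭 ^ t) ℓ) n' i j).card ≤ ℓ :=
  ColDesign.card_matching_le (isColumnDesign_designP ht hn) (isNWDesign_designP ht n' ℓ hn) hij

/-- **The NW predictor of the learner is `predictOfTables`** with the tables `ColDesign.tableList`
and the indices `ColDesign.idxOf` of its column design.
[cite: CarmosinoImpagliazzoKabanetsKolokolova2016, Thm. 2.11 (reconstruction algorithm)] -/
theorem nwPredictor_eq_predictOfTables (D : (Fin (2 ^ ℓ) → Bool) → Bool) (i : Fin (2 ^ ℓ))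
    (z : Fin (𝔭 ^ t * 𝔭 ^ t) → Bool) (w : Fin (2 ^ ℓ) → Bool) (x : Fin n' → Bool) (g : (Fin n' → Bool) → Bool) :
    nwPredictor (designP ht n' ℓ hn) g D i z w x =
      predictOfTables D i (fun j => ColDesign.tableList (colVal (𝔭 ^ t) ℓ) (designP ht n' ℓ hn) g i j z)
        (fun j => ColDesign.idxOf (colVal (𝔭 ^ t) ℓ) n' i j x) w :=
  ColDesign.nwPredictor_eq_predictOfTables (isColumnDesign_designP ht hn) D i z w x g

end Tables

end Modp

end Literature.Computability.Learning
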